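import Literature.AnabelianGeometry.SemiGraphs.UniformSplittingStrictlyCoherentProofs
import HarnessLib

/-!
# [IUTchI] Remark 2.5.3 (i) (T4) in the local presentation: strictly coherent, countable, connected
# semi-graphs of anabelioids (with a vertex) are Galois-countable

Mochizuki, *Inter-universal Teichmüller theory I*, Rmk. 2.5.3 (i), kurims manuscript pp. 52–53
[cite: Mochizuki2012, IUTchI Rem. 2.5.3(i)(T4) p.53]: "(T4) One verifies immediately that every strictly
coherent, countable semi-graph of anabelioids is Galois-countable", where (T2) "Galois-countable"
means "countable, and, moreover, admits a countable collection of finite étale coverings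
`{G_i → G}_{i ∈ I}` such that for any finite étale covering `H → G`, there exists an `i ∈ I` such that
the base-changed covering `H ×_G G_i → G_i` splits over the constituent anabelioid associated to each
component of `G_i`" and (T3) "strictly coherent" means coherent ([SemiAnbd] Def. 2.3 (iii)) with a
uniform bound `N` on the number of topological generators of all `Π_v`, `Π_e`.

The tree PROVES (T4) in the Galois-category vocabulary of [SemiAnbd] §2 (abc-iut-L3-t7,
`SemiGraphOfAnabelioids.isGaloisCountable_of_isStrictlyCoherent`, `GaloisCountableOfStrictlyCoherent.lean`).
This PROOF-ONLY file (abc-iut cell, FRONTIER programme SUBDAG-REFUTE-F1732 brick R4, seat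
abc-iut-w4-d075; theorems only, no definition) proves it in the LOCAL PRESENTATION of §3 — for
`ProfiniteSemiGraph.IsGaloisCountable` (`TemperedCoverings.lean`), the hypothesis field of
`ProfiniteSemiGraph.Prop36Hypotheses` — as a specialisation of the covering-construction step of
[SemiAnbd] Prop. 3.6 (v) already in the tree (`CovObj.uniformSplittingAt_of_isStrictlyCoherent`,
`UniformSplittingStrictlyCoherentProofs.lean`): for each bound `K`, strict coherence gives open
subgroups `U_c ⊆ Π_c` of index `≤ (K!)^((K!)^N)` lying in every open subgroup of index `≤ K`
(`IsTopologicallyFinitelyGenerated.exists_open_normal_le_ker`), quasi-coherence an approximator whose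
kernels lie in the `U_c`, and its trivialising covering (`Approximator.trivCov`, print's Prop. 2.5) is a
finite covering `F_K` with nonempty fibres whose point stabilisers lie in every open subgroup of index
`≤ K` (`exists_finiteCov_stabilizers_le`).  A finite covering `H` of a CONNECTED `G` with a vertex has
constant degree `d` (`CovObj.nodeCard_eq_of_reachable`), the pointwise stabiliser of each fibre of `H` is
open of index `≤ d!`, so `F_{d!}` splits `H` over every constituent (`isGaloisCountable_of_isStrictlyCoherent`).
NO Galois-countability is assumed anywhere (no circularity with `Prop36Hypotheses`); the vertex is used
only to anchor the degree.  Refereed/printed material; nothing here bears on [IUTchIII] Cor. 3.12.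
-/

namespace Literature.AnabelianGeometry.SemiGraphs

open CategoryTheory Topology
open Literature.AnabelianGeometry.AbsoluteAnabelian.IsTopologicallyFinitelyGenerated
  (exists_open_normal_le_ker)
open scoped Nat

universe u

namespace ProfiniteSemiGraph

variable {𝒢 : ProfiniteSemiGraph.{u}}

/-- **The covering `F_K`.**  For a quasi-coherent `G` whose vertex and edge groups are topologically
generated by at most `N` elements (strict coherence, [IUTchI] Rmk. 2.5.3 (i) (T3)) and every `K`, there is
a finite object of `B^cov(G)` with nonempty fibres all of whose point stabilisers — in `Π_v`, resp.
`Π_e` — lie in EVERY open subgroup of index `≤ K` of `Π_v`, resp. `Π_e`: the trivialising covering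
([SemiAnbd] Prop. 2.5) of an approximator splitting the cosets of the characteristic open subgroups of
(T4). [cite: Mochizuki2012, IUTchI Rem. 2.5.3(i)(T4) p.53] -/
theorem exists_finiteCov_stabilizers_le (hqc : 𝒢.IsQuasiCoherent) (hsc : 𝒢.IsStrictlyCoherent) (K : ℕ) :
    ∃ F : CovObj 𝒢, F.IsFinite ∧ F.HasNonemptyFibres ∧
      (∀ (v : 𝒢.graph.Vertex) (z : (F.SV v).obj.V) (g : 𝒢.Gv v), (F.SV v).obj.ρ g z = z →
        ∀ L : Subgroup (𝒢.Gv v), IsOpen (L : Set (𝒢.Gv v)) → L.index ≠ 0 → L.index ≤ K → g ∈ L) ∧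
      (∀ (e : 𝒢.graph.Edge) (z : (F.SE e).obj.V) (g : 𝒢.Ge e), (F.SE e).obj.ρ g z = z →
        ∀ L : Subgroup (𝒢.Ge e), IsOpen (L : Set (𝒢.Ge e)) → L.index ≠ 0 → L.index ≤ K → g ∈ L) := by
  classical
  obtain ⟨N, -, hgenV, hgenE⟩ := hsc.exists_bound
  -- (T4): the characteristic open subgroups `U_v`, `U_e` of bounded index
  let β : ℕ := (K !) ^ ((K !) ^ N)
  have hUV : ∀ v : 𝒢.graph.Vertex, ∃ U : Subgroup (𝒢.Gv v), IsOpen (U : Set (𝒢.Gv v)) ∧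
      U.index ≠ 0 ∧ U.index ≤ β ∧
      ∀ ρ : 𝒢.Gv v →* Equiv.Perm (Fin K), IsOpen (ρ.ker : Set (𝒢.Gv v)) → U ≤ ρ.ker := by
    intro v
    obtain ⟨s, hs, hgen⟩ := hgenV v
    obtain ⟨U, -, hUo, hUi, hUβ, hUker⟩ := exists_open_normal_le_ker s hgen K
    exact ⟨U, hUo, hUi, hUβ.trans (CovObj.bound_mono hs), hUker⟩
  have hUE : ∀ e : 𝒢.graph.Edge, ∃ U : Subgroup (𝒢.Ge e), IsOpen (U : Set (𝒢.Ge e)) ∧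
      U.index ≠ 0 ∧ U.index ≤ β ∧
      ∀ ρ : 𝒢.Ge e →* Equiv.Perm (Fin K), IsOpen (ρ.ker : Set (𝒢.Ge e)) → U ≤ ρ.ker := by
    intro e
    obtain ⟨s, hs, hgen⟩ := hgenE e
    obtain ⟨U, -, hUo, hUi, hUβ, hUker⟩ := exists_open_normal_le_ker s hgen K
    exact ⟨U, hUo, hUi, hUβ.trans (CovObj.bound_mono hs), hUker⟩
  choose UV hUVo hUVi hUVβ hUVker using hUV
  choose UE hUEo hUEi hUEβ hUEker using hUE
  -- quasi-coherence applied to the cosets of the `U_c`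
  haveI : ∀ v, (UV v).FiniteIndex := fun v => ⟨hUVi v⟩
  haveI : ∀ e, (UE e).FiniteIndex := fun e => ⟨hUEi e⟩
  obtain ⟨A, hAV, hAE⟩ := hqc β (fun v => CovObj.cosetsObj (UV v) (hUVo v) (hUVi v))
    (fun e => CovObj.cosetsObj (UE e) (hUEo e) (hUEi e))
    (fun v => ⟨hUVβ v, inferInstanceAs (Finite (𝒢.Gv v ⧸ UV v))⟩)
    (fun e => ⟨hUEβ e, inferInstanceAs (Finite (𝒢.Ge e ⧸ UE e))⟩)
  have hkerV : ∀ v (g : 𝒢.Gv v), A.πV v g = 1 → g ∈ UV v := fun v g hg =>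
    CovObj.mem_of_cosetsObj_fixed (UV v) (hUVo v) (hUVi v) g (hAV v g hg)
  have hkerE : ∀ e (g : 𝒢.Ge e), A.πE e g = 1 → g ∈ UE e := fun e g hg =>
    CovObj.mem_of_cosetsObj_fixed (UE e) (hUEo e) (hUEi e) g (hAE e g hg)
  -- the trivialising covering of `A`
  obtain ⟨M, hM, hdvd⟩ := A.bounded
  refine ⟨A.trivCov hM hdvd, A.trivCov_isFinite hM hdvd, A.trivCov_hasNonemptyFibres hM hdvd,
    fun v z g hz L hLo hLi hLK => ?_, fun e z g hz L hLo hLi hLK => ?_⟩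
  · have hk1 : A.πV v g = 1 := CovObj.πV_eq_one_of_trivCov_ρ_eq A hM hdvd v z g hz
    exact CovObj.le_of_index_le (UV v) (hUVker v) L hLo hLi hLK (hkerV v g hk1)
  · have hk1 : A.πE e g = 1 := CovObj.πE_eq_one_of_trivCov_ρ_eq A hM hdvd e z g hz
    exact CovObj.le_of_index_le (UE e) (hUEker e) L hLo hLi hLK (hkerE e g hk1)

/-- **[IUTchI] Rmk. 2.5.3 (i) (T4), local presentation.**  A connected, countable, strictly coherent
semi-graph of anabelioids with at least one vertex is Galois-countable
(`ProfiniteSemiGraph.IsGaloisCountable`): the countable family `K ↦ F_K` of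
`exists_finiteCov_stabilizers_le` splits every finite object `H` of `B^cov(G)` over every constituent
anabelioid at the index `K := d!`, `d` the (constant) degree of `H`.
[cite: Mochizuki2012, IUTchI Rem. 2.5.3(i)(T4) p.53] -/
theorem isGaloisCountable_of_isStrictlyCoherent (hconn : 𝒢.IsConnected) (hv : 𝒢.HasVertex)
    (hcnt : 𝒢.IsCountable) (hsc : 𝒢.IsStrictlyCoherent) : 𝒢.IsGaloisCountable := by
  classical
  choose F hFfin hFne hFV hFE using
    fun K : ℕ => exists_finiteCov_stabilizers_le hsc.isCoherent.1 hsc K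
  refine ⟨hcnt, F, fun i => ⟨hFfin i, hFne i⟩, fun H hH => ?_⟩
  haveI : ∀ v, Finite (H.SV v).obj.V := hH.finite_V
  haveI : ∀ e, Finite (H.SE e).obj.V := hH.finite_E
  -- constant degree `d` of `H` on the connected `G`
  obtain ⟨v₀⟩ := hv
  let d : ℕ := H.nodeCard (Sum.inl v₀)
  have hd : ∀ n : 𝒢.graph.Node, H.nodeCard n = d := fun n =>
    H.nodeCard_eq_of_reachable (hconn.connected.preconnected n (Sum.inl v₀))
  refine ⟨d !, fun v x g hx s => ?_, fun e x g hx s => ?_⟩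
  · -- the stabiliser of `x ∈ (F_{d!})_v` lies in the (open, index `≤ d!`) fixator of `H_v`
    have hidx : (CovObj.fixator (H.SV v)).index ≤ d ! := by
      have h := CovObj.index_fixator_le (H.SV v)
      have hdv : Nat.card (H.SV v).obj.V = d := hd (Sum.inl v)
      rwa [hdv] at h
    have hmem : g ∈ CovObj.fixator (H.SV v) :=
      hFV (d !) v x g hx (CovObj.fixator (H.SV v)) (CovObj.isOpen_fixator _)
        (CovObj.index_fixator_ne_zero _) hidx
    exact (CovObj.mem_fixator_iff _ _).mp hmem s
  · have hidx : (CovObj.fixator (H.SE e)).index ≤ d ! := by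
      have h := CovObj.index_fixator_le (H.SE e)
      have hde : Nat.card (H.SE e).obj.V = d := hd (Sum.inr (Sum.inl e))
      rwa [hde] at h
    have hmem : g ∈ CovObj.fixator (H.SE e) :=
      hFE (d !) e x g hx (CovObj.fixator (H.SE e)) (CovObj.isOpen_fixator _)
        (CovObj.index_fixator_ne_zero _) hidx
    exact (CovObj.mem_fixator_iff _ _).mp hmem s

/-- The same with the hypotheses of [SemiAnbd] Prop. 3.6 OTHER THAN Galois-countability spelled out
as a bundle-free corollary: connected + has a vertex + countable + strictly coherent ⇒ all of
`(T2)`.  (Convenience form for non-vacuity / countermodel certificates, which then need not build the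
countable cofinal family by hand.) [cite: Mochizuki2012, IUTchI Rem. 2.5.3(i)(T4) p.53] -/
theorem isGaloisCountable_of_isStrictlyCoherent' (hconn : 𝒢.IsConnected) (hv : 𝒢.HasVertex)
    (hV : Countable 𝒢.graph.Vertex) (hE : Countable 𝒢.graph.Edge) (hsc : 𝒢.IsStrictlyCoherent) :
    𝒢.IsGaloisCountable :=
  isGaloisCountable_of_isStrictlyCoherent hconn hv ⟨hV, hE⟩ hsc

end ProfiniteSemiGraph

end Literature.AnabelianGeometry.SemiGraphs
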